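import Mathlib
import Summits.KontsevichZagierPeriods.Zeta5Search.ClusterValuation
import Summits.KontsevichZagierPeriods.Zeta5Search.PalindromicClassBounds
import Summits.KontsevichZagierPeriods.Zeta5Search.PalindromicClassBoundsProof
import Summits.KontsevichZagierPeriods.Zeta5Search.CasoratianClassBoundProof
import Summits.KontsevichZagierPeriods.Zeta5Search.DenomLaw.ThresholdModelConfigRows
import Summits.KontsevichZagierPeriods.Zeta5Search.DenomLaw.ThresholdModelCasoratianPure

/-!
# ζ(5) search — DENOM-LAW: the threshold model, PART V (the Casoratian on the D region), part C: `VB`, `rowMin`, THEOREM LB's `casLB`, the refund, `N_p`, (CV) on a deep cell; kernel examples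

Cell `pub-zeta5`, track DENOM-LAW (K1 typing order item (1), «ThresholdModel port»): denom-engine-d2 g15's kernel-checked scratch module
`denom-law/engine-d2/g15/lean/LevelCensusCasoratian.lean` PART V (THRESHOLD-X7) filed VERBATIM in three parts (≤ 400 lines each) by denom-prover-d1 g5.  Part C of 3.
HONEST FRAMING: systematic search; MODEL-side level combinatorics read against the tree's own `casLB`/`vbMin`/`rowMin` (THEOREM LB) on deep cells; nothing about ζ(5); no γ; no irrationality claim; records in print UNMOVED.
The mathematical header of PART V is the second module docstring of part A (`ThresholdModelCasoratian.lean`).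
-/

namespace Summit.KontsevichZagierPeriods.Zeta5Search.DenomLaw.ThresholdModel.Rho

section Casoratian

open Summit.KontsevichZagierPeriods.Zeta5Search.ClusterValuation (classExp classPoleCount classNu tameSingle vbMin rowMin casLB
  classRowList wLB uLB wLBpal uLBpal casoratianClassBound_holds wLB_le_padicValRat_coeffW uLB_le_padicValRat_coeffU
  vbMin_le_padicValRat_coeffV palindromicClassBoundW_holds palindromicClassBoundU_holds)
open Summit.KontsevichZagierPeriods.Zeta5Search.CasoratianValuation (InPolytope pairFloors refund shift casoratian)
open Summit.KontsevichZagierPeriods.Zeta5Search.WedgeDictionary (dOf coeffW coeffU coeffV)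

/-! ### (X7-2)–(X7-4) `VB`, `rowMin` and THEOREM LB's `casLB` on a deep cell -/

section DeepCas
variable {b : ℕ → ℤ} {p : ℕ} {m u₀ : ℤ}

/-- **`VB(b,p) = E_min` ON A DEEP CELL**: the minimum of `ν_x` over the pole classes is the common class exponent
`score(u₀) − (4m+8)` of the dominant classes (they have `m + 1 ≥ 2` poles, so `ν = E_x` there, and every other pole class has
`ν_x ≥ E_x ≥ E_min + 1` or `= E_min`). -/
theorem vbMin_of_deep (hB : BCell (p : ℤ) ((m - 1) * p) (b 0) (lowerB b)) (hm : 1 ≤ m)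
    (hd₀ : IsDominant (p : ℤ) (R0b p m (b 0)) (rhob p m (b 0) (lowerB b)) u₀) :
    vbMin b p = some (score (p : ℤ) (R0b p m (b 0)) (rhob p m (b 0) (lowerB b)) u₀ - (4 * m + 8)) := by
  have hD : DeepCell (p : ℤ) (R0b p m (b 0)) (rhob p m (b 0) (lowerB b)) := by
    rw [rhob_eq_rhoOf, R0b_eq_R0Of]; exact hB.deepCell
  have hp1 : (1 : ℤ) ≤ p := hD.levelBox.one_le_p
  obtain ⟨x₀, hx₀p, hx₀⟩ := exists_residue_lt (m := m) (b0 := b 0) hp1 u₀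
  have hE₀ := (classExp_of_dominant hB hm hd₀ hx₀).1
  have hpc₀ : 2 ≤ classPoleCount b p x₀ := by have := classPoleCount_of_dominant hB hm hd₀ hx₀; omega
  unfold vbMin
  refine min?_eq_some_of_least ?_ ?_
  · refine List.mem_map.2 ⟨x₀, ?_, ?_⟩
    · refine List.mem_filter.2 ⟨List.mem_range.2 (by exact_mod_cast hx₀p), ?_⟩
      simpa using (show 1 ≤ classPoleCount b p x₀ by omega)
    · rw [classNu_of_multipole hpc₀, hE₀]
  · intro z hz
    obtain ⟨x, hx, hzx⟩ := List.mem_map.1 hz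
    rw [← hzx]
    refine le_trans ?_ (classExp_le_classNu b p x)
    rcases Classical.em (IsDominant (p : ℤ) (R0b p m (b 0)) (rhob p m (b 0) (lowerB b)) (uOf p m (b 0) x)) with hd | hnd
    · rw [(classExp_vs_dominant hB hm hd₀ x).1 hd]
    · have := (classExp_vs_dominant hB hm hd₀ x).2 hnd; omega

/-- **`rowMin = 3 + E_min` ON A DEEP CELL** (Part IV's rung-M minimum `minRow_eq` at `s = 3`; the list is nonempty because the
dominant residue contributes its multipole row). -/
theorem rowMin_of_deep (hB : BCell (p : ℤ) ((m - 1) * p) (b 0) (lowerB b)) (hm : 1 ≤ m)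
    (hd₀ : IsDominant (p : ℤ) (R0b p m (b 0)) (rhob p m (b 0) (lowerB b)) u₀) :
    rowMin b p = some (3 + (score (p : ℤ) (R0b p m (b 0)) (rhob p m (b 0) (lowerB b)) u₀ - (4 * m + 8))) := by
  have hD : DeepCell (p : ℤ) (R0b p m (b 0)) (rhob p m (b 0) (lowerB b)) := by
    rw [rhob_eq_rhoOf, R0b_eq_R0Of]; exact hB.deepCell
  have hp1 : (1 : ℤ) ≤ p := hD.levelBox.one_le_p
  obtain ⟨x₀, hx₀p, hx₀⟩ := exists_residue_lt (m := m) (b0 := b 0) hp1 u₀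
  have hpc₀ : 2 ≤ classPoleCount b p x₀ := by have := classPoleCount_of_dominant hB hm hd₀ hx₀; omega
  have hmem : (3 + classExp b p x₀) ∈ classRowList b p 3 :=
    List.mem_filterMap.2 ⟨x₀, List.mem_range.2 (by exact_mod_cast hx₀p), by rw [if_neg (by omega), if_pos hpc₀]⟩
  have hne : (classRowList b p 3 ++ (if dOf b < (p : ℤ) then [0] else [])) ≠ [] :=
    List.ne_nil_of_mem (List.mem_append.2 (Or.inl hmem))
  rw [rowMin_eq_classRowList, min?_eq_some_getD hne, minRow_eq hB hm (by omega) hd₀ (dOf b < (p : ℤ))]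

/-- **THEOREM LB's BOUND ON A DEEP CELL IN CLOSED FORM: `casLB b p = 2·E_min + 3 = 2·score(u₀) − 8m − 13`.** -/
theorem casLB_of_deep (hB : BCell (p : ℤ) ((m - 1) * p) (b 0) (lowerB b)) (hm : 1 ≤ m)
    (hd₀ : IsDominant (p : ℤ) (R0b p m (b 0)) (rhob p m (b 0) (lowerB b)) u₀) :
    casLB b p = 2 * (score (p : ℤ) (R0b p m (b 0)) (rhob p m (b 0) (lowerB b)) u₀ - (4 * m + 8)) + 3 := by
  simp only [casLB, vbMin_of_deep hB hm hd₀, rowMin_of_deep hB hm hd₀]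
  ring

/-- the same number read as `2·score(u₀) − 8m − 13`. -/
theorem casLB_of_deep' (hB : BCell (p : ℤ) ((m - 1) * p) (b 0) (lowerB b)) (hm : 1 ≤ m)
    (hd₀ : IsDominant (p : ℤ) (R0b p m (b 0)) (rhob p m (b 0) (lowerB b)) u₀) :
    casLB b p = 2 * score (p : ℤ) (R0b p m (b 0)) (rhob p m (b 0) (lowerB b)) u₀ - 8 * m - 13 := by
  rw [casLB_of_deep hB hm hd₀]; ring

/-- **`casLB = vbMin + wLB` = `E_min + wLB`**: on the D region THEOREM LB is the product of the `V`-floor and rung M for `W`,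
term by term (no cross credit between the two factors of the Casoratian). -/
theorem casLB_eq_wLB_add (hB : BCell (p : ℤ) ((m - 1) * p) (b 0) (lowerB b)) (hm : 1 ≤ m)
    (hd₀ : IsDominant (p : ℤ) (R0b p m (b 0)) (rhob p m (b 0) (lowerB b)) u₀) :
    casLB b p = wLB b p + (score (p : ℤ) (R0b p m (b 0)) (rhob p m (b 0) (lowerB b)) u₀ - (4 * m + 8)) := by
  rw [casLB_of_deep hB hm hd₀, wLB_of_deep hB hm hd₀]; ring

/-! ### (X7-5) the excess `d(b)` and the refund on a deep cell -/

/-- **`2·d(b) = Σ_j ρ_j − R₀ + (4m − 5)p`** (pure bookkeeping: `ρ_j = b₀ − 2b_j − (m−1)p`, `R₀ = b₀ − (3m−2)p`). -/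
theorem two_mul_dOf_eq (b : ℕ → ℤ) (p : ℕ) (m : ℤ) :
    2 * dOf b = (∑ j : Fin 7, rhob p m (b 0) (lowerB b) j) - R0b p m (b 0) + (4 * m - 5) * p := by
  unfold dOf R0b
  rw [Finset.sum_range]
  simp only [Fin.sum_univ_seven, rhob, lowerB_apply]
  ring

/-- **`d(b) ≥ p + 2` ON A DEEP CELL** (so `p ≤ d`, `p ≤ d + 1`, `4p ≤ 2d + 3` unless `m = 1`…: the first two always). -/
theorem dOf_of_deep (hB : BCell (p : ℤ) ((m - 1) * p) (b 0) (lowerB b)) (hm : 1 ≤ m) : (p : ℤ) + 2 ≤ dOf b := by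
  have hD : DeepCell (p : ℤ) (R0b p m (b 0)) (rhob p m (b 0) (lowerB b)) := by
    rw [rhob_eq_rhoOf, R0b_eq_R0Of]; exact hB.deepCell
  have h6 := hD.six_p_lt_sum_r
  have hR := hD.R0_bounds.2
  have h2 := two_mul_dOf_eq b p m
  have hp3 : (3 : ℤ) ≤ p := by exact_mod_cast hB.three_le_p
  nlinarith

/-- **`refund b p = 1` ON A DEEP CELL.** -/
theorem refund_of_deep (hB : BCell (p : ℤ) ((m - 1) * p) (b 0) (lowerB b)) (hm : 1 ≤ m) : refund b p = 1 := by
  have hd := dOf_of_deep hB hm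
  have hp0 : (0 : ℤ) < p := by have := hB.three_le_p; omega
  have h1 : 1 ≤ dOf b / (p : ℤ) := (Int.le_ediv_iff_mul_le hp0).2 (by linarith)
  unfold refund; exact min_eq_left h1

/-! ### (X7-6) `N_p = pairFloors` on a deep cell -/

/-- **`pairFloors b p = 21(m − 1) + π(ρ)` ON A D CELL** (only the pair-digit window of `BCell` is used). -/
theorem pairFloors_of_deep (hB : BCell (p : ℤ) ((m - 1) * p) (b 0) (lowerB b)) :
    pairFloors b p = 21 * (m - 1) + pairHigh (p : ℤ) (rhob p m (b 0) (lowerB b)) := by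
  have hp0 : (0 : ℤ) < p := by have := hB.three_le_p; omega
  unfold pairFloors pairHigh
  rw [sum_range_seven_sq, ← sum_pairs_add]
  refine Finset.sum_congr rfl fun j _ => Finset.sum_congr rfl fun k _ => ?_
  by_cases hjk : j < k
  · rw [if_pos (show ((j : ℕ) < (k : ℕ)) from hjk), if_pos hjk]
    obtain ⟨h1, h2⟩ := hB.pair j k (ne_of_lt hjk)
    simp only [lowerB_apply] at h1 h2
    rw [ediv_two_window hp0 h1 h2]
    congr 1
    refine indic_congr ?_
    simp only [rhob, lowerB_apply]
    constructor <;> intro h <;> nlinarith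
  · rw [if_neg (show ¬ ((j : ℕ) < (k : ℕ)) from hjk), if_neg hjk]

/-! ### (X7-7) THEOREM LB versus the (CV) law on a deep cell -/

/-- **`LB − (refund − N_p) = 13m + π(ρ) + 2·score(u₀) − 35`.** -/
theorem casLB_sub_cv_of_deep (hB : BCell (p : ℤ) ((m - 1) * p) (b 0) (lowerB b)) (hm : 1 ≤ m)
    (hd₀ : IsDominant (p : ℤ) (R0b p m (b 0)) (rhob p m (b 0) (lowerB b)) u₀) :
    casLB b p - (refund b p - pairFloors b p) =
      13 * m + pairHigh (p : ℤ) (rhob p m (b 0) (lowerB b)) +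
        2 * score (p : ℤ) (R0b p m (b 0)) (rhob p m (b 0) (lowerB b)) u₀ - 35 := by
  rw [casLB_of_deep hB hm hd₀, refund_of_deep hB hm, pairFloors_of_deep hB]; ring

/-- **THEOREM LB's bound is at least the (CV) right-hand side plus `13m − 14` on EVERY deep cell** (`π + 2·score ≥ 21`);
so for `m ≥ 2` LB exceeds (CV) by `≥ 12`, and at `m = 1` LB `≥ (CV) − 1`. -/
theorem cv_add_le_casLB_of_deep (hB : BCell (p : ℤ) ((m - 1) * p) (b 0) (lowerB b)) (hm : 1 ≤ m) :
    refund b p - pairFloors b p + (13 * m - 14) ≤ casLB b p := by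
  have hD : DeepCell (p : ℤ) (R0b p m (b 0)) (rhob p m (b 0) (lowerB b)) := by
    rw [rhob_eq_rhoOf, R0b_eq_R0Of]; exact hB.deepCell
  obtain ⟨u₀, hd₀⟩ := hD.exists_dominant
  have h := casLB_sub_cv_of_deep hB hm hd₀
  have h21 := (hD.twentyone_le_pairHigh_add_two_score u₀).1
  linarith

/-- **… with equality exactly on the «pure» cells**: `LB = (CV) + (13m − 14)` forces `π = 21` (all 21 pair digits equal to `m`)
and a dominant class of score `0` (no root at `±m/2`, `±3m/2`). -/
theorem pure_of_casLB_eq_cv_add (hB : BCell (p : ℤ) ((m - 1) * p) (b 0) (lowerB b)) (hm : 1 ≤ m)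
    (hd₀ : IsDominant (p : ℤ) (R0b p m (b 0)) (rhob p m (b 0) (lowerB b)) u₀)
    (he : casLB b p = refund b p - pairFloors b p + (13 * m - 14)) :
    pairHigh (p : ℤ) (rhob p m (b 0) (lowerB b)) = 21 ∧ score (p : ℤ) (R0b p m (b 0)) (rhob p m (b 0) (lowerB b)) u₀ = 0 := by
  have hD : DeepCell (p : ℤ) (R0b p m (b 0)) (rhob p m (b 0) (lowerB b)) := by
    rw [rhob_eq_rhoOf, R0b_eq_R0Of]; exact hB.deepCell
  have h := casLB_sub_cv_of_deep hB hm hd₀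
  exact (hD.twentyone_le_pairHigh_add_two_score u₀).2 (by linarith)

/-- at `m = 1`: LB implies (CV) on every deep cell that is NOT pure (`¬ (π = 21 ∧ score(u₀) = 0)` for a dominant `u₀`). -/
theorem cv_le_casLB_of_deep_m_one (hB : BCell (p : ℤ) ((1 - 1) * p) (b 0) (lowerB b))
    (hd₀ : IsDominant (p : ℤ) (R0b p 1 (b 0)) (rhob p 1 (b 0) (lowerB b)) u₀)
    (hnp : ¬ (pairHigh (p : ℤ) (rhob p 1 (b 0) (lowerB b)) = 21 ∧
      score (p : ℤ) (R0b p 1 (b 0)) (rhob p 1 (b 0) (lowerB b)) u₀ = 0)) :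
    refund b p - pairFloors b p ≤ casLB b p := by
  have hD : DeepCell (p : ℤ) (R0b p 1 (b 0)) (rhob p 1 (b 0) (lowerB b)) := by
    rw [rhob_eq_rhoOf, R0b_eq_R0Of]; exact hB.deepCell
  have h := casLB_sub_cv_of_deep hB le_rfl hd₀
  obtain ⟨h21, heq⟩ := hD.twentyone_le_pairHigh_add_two_score u₀
  by_contra hc
  exact hnp (heq (by linarith))

/-! ### (X7-8) the tree's PROVED valuation bounds, read on a deep cell -/

/-- **`v_p(V(b)) ≥ E_min`** (the tree's `vbMin_le_padicValRat_coeffV`, with `VB = E_min`). -/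
theorem padicValRat_coeffV_ge_of_deep [Fact p.Prime] (hB : BCell (p : ℤ) ((m - 1) * p) (b 0) (lowerB b)) (hm : 1 ≤ m)
    (hd₀ : IsDominant (p : ℤ) (R0b p m (b 0)) (rhob p m (b 0) (lowerB b)) u₀)
    (hb : InPolytope b) (hp5 : 5 ≤ p) (hwin : (b 0 + 2 : ℤ) < (p : ℤ) ^ 2) (hV : coeffV b ≠ 0) :
    score (p : ℤ) (R0b p m (b 0)) (rhob p m (b 0) (lowerB b)) u₀ - (4 * m + 8) ≤ padicValRat p (coeffV b) :=
  vbMin_le_padicValRat_coeffV b hb hp5 hwin (vbMin_of_deep hB hm hd₀) hV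

/-- **`v_p(W(b)) ≥ 3 + E_min`** (rung M: `wLB_le_padicValRat_coeffW` with Part IV's `wLB_of_deep`). -/
theorem padicValRat_coeffW_ge_of_deep [Fact p.Prime] (hB : BCell (p : ℤ) ((m - 1) * p) (b 0) (lowerB b)) (hm : 1 ≤ m)
    (hd₀ : IsDominant (p : ℤ) (R0b p m (b 0)) (rhob p m (b 0) (lowerB b)) u₀)
    (hb : InPolytope b) (hp5 : 5 ≤ p) (hwin : (b 0 + 2 : ℤ) < (p : ℤ) ^ 2) (hW : coeffW b ≠ 0) :
    3 + (score (p : ℤ) (R0b p m (b 0)) (rhob p m (b 0) (lowerB b)) u₀ - (4 * m + 8)) ≤ padicValRat p (coeffW b) := by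
  rw [← wLB_of_deep hB hm hd₀]; exact wLB_le_padicValRat_coeffW b hb hp5 hwin hW

/-- **`v_p(W(b)) ≥ 4 + E_min` when every dominant class fires the palindrome bonus** (rung K: `palindromicClassBoundW_holds`
with Part IV's `wLBpal_of_deep_all`). -/
theorem padicValRat_coeffW_ge_of_deep_pal (hB : BCell (p : ℤ) ((m - 1) * p) (b 0) (lowerB b)) (hm : 1 ≤ m)
    (hd₀ : IsDominant (p : ℤ) (R0b p m (b 0)) (rhob p m (b 0) (lowerB b)) u₀)
    (hall : ∀ v, IsDominant (p : ℤ) (R0b p m (b 0)) (rhob p m (b 0) (lowerB b)) v →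
      (v ≠ 0 ∧ L (p : ℤ) (rhob p m (b 0) (lowerB b)) v = R (p : ℤ) (rhob p m (b 0) (lowerB b)) v ∧
        np (p : ℤ) (R0b p m (b 0)) v = nm (p : ℤ) (R0b p m (b 0)) v))
    (hb : InPolytope b) (hprime : p.Prime) (hp5 : 5 ≤ p) (hwin : (b 0 + 2 : ℤ) < (p : ℤ) ^ 2) (hW : coeffW b ≠ 0) :
    3 + (score (p : ℤ) (R0b p m (b 0)) (rhob p m (b 0) (lowerB b)) u₀ - (4 * m + 8)) + 1 ≤ padicValRat p (coeffW b) := by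
  rw [← wLBpal_of_deep_all hB hm hd₀ hall]; exact palindromicClassBoundW_holds b p hb hprime hp5 hwin hW

/-- **`v_p(U(b)) ≥ 5 + E_min`** (rung M for `U`). -/
theorem padicValRat_coeffU_ge_of_deep [Fact p.Prime] (hB : BCell (p : ℤ) ((m - 1) * p) (b 0) (lowerB b)) (hm : 1 ≤ m)
    (hd₀ : IsDominant (p : ℤ) (R0b p m (b 0)) (rhob p m (b 0) (lowerB b)) u₀)
    (hb : InPolytope b) (hp5 : 5 ≤ p) (hwin : (b 0 + 2 : ℤ) < (p : ℤ) ^ 2) (hU : coeffU b ≠ 0) :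
    5 + (score (p : ℤ) (R0b p m (b 0)) (rhob p m (b 0) (lowerB b)) u₀ - (4 * m + 8)) ≤ padicValRat p (coeffU b) := by
  rw [← uLB_of_deep hB hm hd₀]; exact uLB_le_padicValRat_coeffU b hb hp5 hwin hU

/-- **`v_p(U(b)) ≥ 6 + E_min` when every dominant class fires the bonus** (rung K for `U`). -/
theorem padicValRat_coeffU_ge_of_deep_pal (hB : BCell (p : ℤ) ((m - 1) * p) (b 0) (lowerB b)) (hm : 1 ≤ m)
    (hd₀ : IsDominant (p : ℤ) (R0b p m (b 0)) (rhob p m (b 0) (lowerB b)) u₀)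
    (hall : ∀ v, IsDominant (p : ℤ) (R0b p m (b 0)) (rhob p m (b 0) (lowerB b)) v →
      (v ≠ 0 ∧ L (p : ℤ) (rhob p m (b 0) (lowerB b)) v = R (p : ℤ) (rhob p m (b 0) (lowerB b)) v ∧
        np (p : ℤ) (R0b p m (b 0)) v = nm (p : ℤ) (R0b p m (b 0)) v))
    (hb : InPolytope b) (hprime : p.Prime) (hp5 : 5 ≤ p) (hwin : (b 0 + 2 : ℤ) < (p : ℤ) ^ 2) (hU : coeffU b ≠ 0) :
    5 + (score (p : ℤ) (R0b p m (b 0)) (rhob p m (b 0) (lowerB b)) u₀ - (4 * m + 8)) + 1 ≤ padicValRat p (coeffU b) := by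
  rw [← uLBpal_of_deep_all hB hm hd₀ hall]; exact palindromicClassBoundU_holds b p hb hprime hp5 hwin hU

/-- **`v_p(Cas_j(b)) ≥ 2·E_min + 3 = 2·score(u₀) − 8m − 13`** — THEOREM LB (`casoratianClassBound_holds`) read on a deep cell. -/
theorem padicValRat_casoratian_ge_of_deep (hB : BCell (p : ℤ) ((m - 1) * p) (b 0) (lowerB b)) (hm : 1 ≤ m)
    (hd₀ : IsDominant (p : ℤ) (R0b p m (b 0)) (rhob p m (b 0) (lowerB b)) u₀)
    (hb : InPolytope b) {j : ℕ} (hj1 : 1 ≤ j) (hj7 : j ≤ 7) (hb' : InPolytope (shift b j)) (hprime : p.Prime)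
    (hp5 : 5 ≤ p) (hwin : (b 0 + 2 : ℤ) < (p : ℤ) ^ 2) (hcas : casoratian b j ≠ 0) :
    2 * score (p : ℤ) (R0b p m (b 0)) (rhob p m (b 0) (lowerB b)) u₀ - 8 * m - 13 ≤ padicValRat p (casoratian b j) := by
  rw [← casLB_of_deep' hB hm hd₀]; exact casoratianClassBound_holds b j p hb hj1 hj7 hb' hprime hp5 hwin hcas

/-- **(CV) ON THE D REGION IS A CONSEQUENCE OF THEOREM LB, WITH SLACK `13m − 14`**: for a deep tree cell of octave `m` and the
hypotheses of `CasoratianValuationLaw` (polytope, `1 ≤ j ≤ 7`, window prime `p ≥ 5`, `Cas_j(b) ≠ 0`):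
`refund − N_p + (13m − 14) ≤ v_p(Cas_j(b))`.  For `m ≥ 2` this contains the OBSERVED law (CV) with `12` to spare; at `m = 1` it is
(CV) minus one. -/
theorem casoratianValuationLaw_of_deep (hB : BCell (p : ℤ) ((m - 1) * p) (b 0) (lowerB b)) (hm : 1 ≤ m)
    (hb : InPolytope b) {j : ℕ} (hj1 : 1 ≤ j) (hj7 : j ≤ 7) (hb' : InPolytope (shift b j)) (hprime : p.Prime)
    (hp5 : 5 ≤ p) (hwin : (b 0 + 2 : ℤ) < (p : ℤ) ^ 2) (hcas : casoratian b j ≠ 0) :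
    refund b p - pairFloors b p + (13 * m - 14) ≤ padicValRat p (casoratian b j) :=
  le_trans (cv_add_le_casLB_of_deep hB hm) (casoratianClassBound_holds b j p hb hj1 hj7 hb' hprime hp5 hwin hcas)

/-- the octave-`≥ 2` reading: (CV) itself, indeed `+ 12`. -/
theorem casoratianValuationLaw_of_deep_two_le (hB : BCell (p : ℤ) ((m - 1) * p) (b 0) (lowerB b)) (hm : 2 ≤ m)
    (hb : InPolytope b) {j : ℕ} (hj1 : 1 ≤ j) (hj7 : j ≤ 7) (hb' : InPolytope (shift b j)) (hprime : p.Prime)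
    (hp5 : 5 ≤ p) (hwin : (b 0 + 2 : ℤ) < (p : ℤ) ^ 2) (hcas : casoratian b j ≠ 0) :
    refund b p - pairFloors b p + 12 ≤ padicValRat p (casoratian b j) := by
  have h := casoratianValuationLaw_of_deep hB (by omega) hb hj1 hj7 hb' hprime hp5 hwin hcas
  have : (12 : ℤ) ≤ 13 * m - 14 := by omega
  linarith

/-- the octave-1 reading: (CV) from LB on every deep cell that is not pure. -/
theorem casoratianValuationLaw_of_deep_m_one (hB : BCell (p : ℤ) ((1 - 1) * p) (b 0) (lowerB b))
    (hd₀ : IsDominant (p : ℤ) (R0b p 1 (b 0)) (rhob p 1 (b 0) (lowerB b)) u₀)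
    (hnp : ¬ (pairHigh (p : ℤ) (rhob p 1 (b 0) (lowerB b)) = 21 ∧
      score (p : ℤ) (R0b p 1 (b 0)) (rhob p 1 (b 0) (lowerB b)) u₀ = 0))
    (hb : InPolytope b) {j : ℕ} (hj1 : 1 ≤ j) (hj7 : j ≤ 7) (hb' : InPolytope (shift b j)) (hprime : p.Prime)
    (hp5 : 5 ≤ p) (hwin : (b 0 + 2 : ℤ) < (p : ℤ) ^ 2) (hcas : casoratian b j ≠ 0) :
    refund b p - pairFloors b p ≤ padicValRat p (casoratian b j) :=
  le_trans (cv_le_casLB_of_deep_m_one hB hd₀ hnp) (casoratianClassBound_holds b j p hb hj1 hj7 hb' hprime hp5 hwin hcas)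

end DeepCas

/-! ### Kernel examples (`decide` on the tree's definitions) -/

section CasExamples

/-- `palCell = (30; 12,9,9,7,7,7,7)` at `p = 11`, `m = 1`: `E_min = −10` (Part IV), so `VB = −10`, `rowMin = −7`,
`LB = −17 = 2·(−10) + 3`; `d = 32`, `refund = 1`, `N_p = 19 = π` (the two pairs `(12,9)` have the lower digit `0`);
`LB − (refund − N_p) = −17 + 18 = 1 = 13 + 19 + 2·2 − 35`. -/
example : vbMin palCell 11 = some (-10) ∧ rowMin palCell 11 = some (-7) ∧ casLB palCell 11 = -17 ∧
    dOf palCell = 32 ∧ refund palCell 11 = 1 ∧ pairFloors palCell 11 = 19 ∧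
    pairHigh 11 (rhob 11 1 (palCell 0) (lowerB palCell)) = 19 ∧
    score 11 (R0b 11 1 (palCell 0)) (rhob 11 1 (palCell 0) (lowerB palCell)) 1 = 2 := by
  refine ⟨by decide, by decide, by decide, by decide, by decide, by decide, by decide, by decide⟩

/-- its octave-2 image `σ₁ palCell = (63; 23,20,20,18,18,18,18)` at `p = 11` (`m = 2`, same `ρ`, `R₀`, `u`; `E_min = −14`):
`LB = −25`, `N_p = 21 + 19 = 40`, `refund = 1`, so `LB − (refund − N_p) = 14 = 26 + 19 + 4 − 35 ≥ 8`. -/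
def palCell2 : ℕ → ℤ := fun i => [63, 23, 20, 20, 18, 18, 18, 18].getD i 0

example : casLB palCell2 11 = -25 ∧ pairFloors palCell2 11 = 40 ∧ refund palCell2 11 = 1 ∧
    rhob 11 2 (palCell2 0) (lowerB palCell2) = rhob 11 1 (palCell 0) (lowerB palCell) := by
  refine ⟨by decide, by decide, by decide, ?_⟩
  funext j; fin_cases j <;> decide

/-- the deep `m = 1` cell `pureCell = (20; 4,4,4,4,4,4,4)` at `p = 11`: `ρ_j = 12` for all `j`, `R₀ = 9`; the classes `u = ±1` have
score `0` (no root at `±m/2`, `±3m/2`: two poles of order `6`, residues `x = 4, 5`, `E_x = −12`), `π = 21`: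
`VB = −12`, `rowMin = −9`, `casLB = −21`, while `refund − N_p = 1 − 21 = −20` — THEOREM LB is one unit SHORT of the observed
(CV) here (`π + 2·score_min = 21`, the equality case of `twentyone_le_pairHigh_add_two_score`). -/
def pureCell : ℕ → ℤ := fun i => [20, 4, 4, 4, 4, 4, 4, 4].getD i 0

example : rhob 11 1 (pureCell 0) (lowerB pureCell) = ![12, 12, 12, 12, 12, 12, 12] ∧ R0b 11 1 (pureCell 0) = 9 ∧
    score 11 9 ![12, 12, 12, 12, 12, 12, 12] 1 = 0 ∧ uOf 11 1 20 4 = 1 ∧ classExp pureCell 11 4 = -12 ∧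
    classPoleCount pureCell 11 4 = 2 ∧ pairHigh 11 ![12, 12, 12, 12, 12, 12, 12] = 21 ∧
    vbMin pureCell 11 = some (-12) ∧ rowMin pureCell 11 = some (-9) ∧ casLB pureCell 11 = -21 ∧
    refund pureCell 11 - pairFloors pureCell 11 = -20 := by
  refine ⟨?_, by decide, by decide, by decide, by decide, by decide, by decide, by decide, by decide, by decide, by decide⟩
  funext j; fin_cases j <;> decide

/-- … and `pureCell` IS a deep D cell at `(1, 11)` (Part I's `BCell` hypotheses, by `decide`), so the hypothesis `m ≥ 2` of
`casoratianValuationLaw_of_deep_two_le` (resp. «not pure» at `m = 1`) cannot be dropped. -/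
example : BCell (11 : ℤ) ((1 - 1) * 11) (pureCell 0) (lowerB pureCell) := by
  refine ⟨by decide, by decide, Fin.antitone_iff_succ_le.2 (by decide), by decide, by decide, ?_⟩
  unfold IsDeepCountB; decide

end CasExamples

end Casoratian

end Summit.KontsevichZagierPeriods.Zeta5Search.DenomLaw.ThresholdModel.Rho
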